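import Summits.NavierStokesRegularity.FluidComputer.GateBudgetSwingFloor
import Summits.NavierStokesRegularity.FluidComputer.GateBudgetSwingTransferBack
import HarnessLib

/-!
# GateBudget part 110 — the swing transfer from below, II: exit half, band floor (§293–§294)

Cell `pub-fluidc`, blueprint seat bp1 (gen 39, fifth item); namespace
`Summit.NavierStokesRegularity.FluidComputer.GateBudget`, knob family
`RotorKnob.rotorCircuit K M ε ρ` (modes `0 = a` carrier, `1 = b` clock, `2 = c` trigger,
`3 = d` transfer, `4 = ã` output) from `delayInit`, trigger primitive `C` (`C' = c`). Imports
part 109 (`GateBudgetSwingFloor`: the entry half from below) and part 102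
(`GateBudgetSwingTransferBack`: the backward comparison angle), through them parts 99, 101.
HONEST FRAMING: a low prior, high value-of-information experiment on Tao's machine paradigm;
NOT a claim that NS blows up. Nothing here is about the Navier–Stokes equations.

THE POINT (SPEC-INPUT-bp1 §CF(3)(b): the NECESSITY side of the swing law; second file). Part
109 ran part 101's entry half-band law FROM BELOW; this file does the same to part 102: on the
EXIT half `C(t₁) + C(t₂) ≤ 2C(t)` the backward comparison angle `v = α₁ + λ(C(t₂) - C)`
(`λ = ε⁻¹Mκ`, part 102 §280(a)) satisfies `v ≤ α ≤ π - v` (part 101 §279(a)) and — by part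
109 §292(a), the upper angle law run from the exit edge — `π - v - ℓ ≤ α`,
`ℓ = 2δ + (π/2)(κ⁻¹ - 1)`; so `sin α = sin(π - α) ≤ sin v + ℓ ≤ (1 + ℓ/sin α₁)sin v`, the
trigger is `≤ R₂ sin v/η` (`η = κ/(1 + ℓ/sin α₁)`, the SAME factor as on the entry half), the
phase of the transfer mode is `-(v + ψ₂)` up to a lag `≤ (π/2)(κ⁻¹ - 1)` (part 102's exit
offset `ψ₂`), and part 109 §291(c)'s sign-split step makes
`ã + (KAη/(λR₂))·swingPrim ψ₂ (-E₁) (v)` NON-DECREASING on `[t, t₂]`: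
`ã(t₂) - ã(t) ≥ (KAη/(λR₂))·(swingPrim ψ₂ (-E₁) (v(t)) - swingPrim ψ₂ (-E₁) α₁)`. At a dose
midpoint `2C(t_m) = C(t₁) + C(t₂)` (intermediate value theorem, as in part 102 §281) the two
comparison angles AGREE, `w(t_m) = v(t_m) = ω` with `α₁ ≤ ω ≤ π/2` and
`cos ω ≤ (1 - κ)π/2 + δ` (part 109 §292(c)); adding the two half-band laws and pricing both
with part 109 §291(d) gives THE BAND FLOOR
`ã(t₂) - ã(t₁) ≥ (KAη/(λR₂))·((cos 2ψ₁ + cos 2ψ₂)(cos α₁ - (1 - κ)π/2 - δ)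
- (|sin 2ψ₁| + |sin 2ψ₂|)(1 - sin α₁) + 2E₁ log tan(α₁/2))` whenever `cos 2ψ₁ + cos 2ψ₂ ≥ 0`
(written `cos²ψ - sin²ψ`) — the lower twin of part 102 §281's ceiling
`(KA/(λR₂))·((cos²ψ₁ + cos²ψ₂)cos α₁ + (|sin 2ψ₁| + |sin 2ψ₂|)(1 - sin α₁)
- (sin²ψ₁ + sin²ψ₂ + 2E₁) log tan(α₁/2))`. NUMBERS (forecast inputs `cos α₁ = 31/32`,
`|ψ₁|, |ψ₂| ≤ 0.0075`, `E₁ = 4.2·10⁻⁴`, `1 - κ = 10⁻⁴`, `δ = 6·10⁻⁶`, `η = 0.9992`): floor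
`≈ 1.911·KA/(λR₂)` per band against the ceiling `≈ 1.96` and part 71's crude `π/2 ≈ 1.571`
used by part 72; with `KAη/(λR₂) ≥ 0.978·A/(θK⁹)`-type headline coefficients (the sequel)
the floor per band swing is `≈ 1.29/K⁹` (`θ ≤ 29/20`, `A ≥ 0.979`) and part 72's necessity
ceiling `K⁹/7 + 1` becomes `≈ 0.110K⁹ + 1` — FORECAST until the discharge is typed.

* §293 `swing_transfer_second_ge`: THE EXIT HALF-BAND LAW FROM BELOW (hypotheses of part 109
  §292(b) with the exit offset `ψ₂` of part 102 §280(b)): for `t` in the exit half,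
  `0 < η ≤ 1`, `0 < α₁`, `C(t) ≤ C(t₂)`, `v(t) ≤ π/2` and
  `(KAη/(λR₂))·(swingPrim ψ₂ (-E₁) (v(t)) - swingPrim ψ₂ (-E₁) α₁) ≤ ã(t₂) - ã(t)`.
* §294 `swing_transfer_band_ge`: THE BAND FLOOR (both offsets, `E ≥ 0`,
  `cos²ψ₁ - sin²ψ₁ + cos²ψ₂ - sin²ψ₂ ≥ 0`), displayed above.
* §295 `abs_arccos_sub_arccos_le`: `|arccos x - arccos y| ≤ |x - y|/√(1 - m²)` for
  `|x|, |y| ≤ m < 1` — the device that will discharge the angle gap `δ` (`≈ 6.5·10⁻⁶`).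

HONEST LIMITS. (i) Generic in the member: the phase lock from below
`A(sin²(Φ + φ₀) - E) ≤ d²`, the outer ring `R₁`, the angle gap `δ`, the aspect defect `κ` and
`c > 0` are ASSUMED on the band; the headline discharge (`R₁`, `R₂`, `κ = 0.9999`, `δ` by an
arccos-Lipschitz bound, `E`, `ψ₁`, `ψ₂` from parts 102–103's inputs, `η ≥ 0.998`, the
coefficient against `A/(θK⁹)`) is the sequel, part 111; (ii) `k = 1` only; (iii) the re-count
of part 72 §219 is NOT here — `N ≤ K⁹/7 + 1` STANDS, `≈ 0.110K⁹ + 1` is a FORECAST;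
(iv) nothing about Navier–Stokes.
[cite: Tao2016AveragedNS, §5.5 Theorem 5.3, (5.5), (b-eq), (c-eq), (ta-eq), (energy-con)]
-/

noncomputable section

namespace Summit.NavierStokesRegularity.FluidComputer.GateBudget

open Real Set Filter Topology
open Literature.Analysis.FluidPDE.Tao2016AveragedNS

variable {K M ε ρ : ℝ} {X : ℝ → Fin 5 → ℝ} {C : ℝ → ℝ}

/-! ## §293 The exit half band from below -/

/-- §293 THE EXIT HALF-BAND LAW FROM BELOW (any member from `delayInit`, `K ≥ 0`, `ε, M > 0`,
UNIT LATTICE `ε⁻¹Mρ² = 1`; on the band `[t₁, t₂]`: the hypotheses of part 109 §292(b) —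
part 101 §279(a)'s ring, band, aspect defect `κc ≤ √(R₂² - b²)`, `c > 0`, symmetric edges,
the outer ring `b² + c² ≤ R₁²`, the angle gap `|arccos(b/R₁) - arccos(b/R₂)| ≤ δ`, `δ ≥ 0`,
`0 < κ ≤ 1`, `A ≥ 0`, the phase lock FROM BELOW `A(sin²((C - C(r))/ρ² + φ₀) - E) ≤ d²`;
`λ = ε⁻¹Mκ`, `α₁ = arccos(b(t₁)/R₂)`, part 102's EXIT OFFSET
`ψ₂ = -(α₁ + (C(t₁) - C(r))/ρ² + φ₀ + ε⁻¹M(C(t₂) - C(t₁)))`, `E₁ = E + π(κ⁻¹ - 1)`,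
`η = κ/(1 + (2δ + (π/2)(κ⁻¹ - 1))/sin α₁)`). For `t ∈ [t₁, t₂]` in the EXIT HALF
`C(t₁) + C(t₂) ≤ 2C(t)`: `0 < η ≤ 1`, `0 < α₁`, `C(t) ≤ C(t₂)`, `v(t) = α₁ + λ(C(t₂) - C(t)) ≤ π/2`
and `(KAη/(λR₂))·(swingPrim ψ₂ (-E₁) (v(t)) - swingPrim ψ₂ (-E₁) α₁) ≤ ã(t₂) - ã(t)`
(the comparison `ã + (KAη/(λR₂))·swingPrim ψ₂ (-E₁) (v)` is non-decreasing on `[t, t₂]`).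
[derived: parts 99 §274–§275, 101 §279(a), 102 §280(a), 109 §291–§292(a)] -/
theorem swing_transfer_second_ge
    (hX : ∀ t, HasDerivAt X (RotorKnob.rotorCircuit K M ε ρ (X t)) t) (h0 : X 0 = delayInit)
    (hC : ∀ t, HasDerivAt C (X t 2) t) (hK : 0 ≤ K) (hε : 0 < ε) (hM : 0 < M)
    (hlat : ε⁻¹ * M * ρ ^ 2 = 1) {t₁ t₂ r R₁ R₂ Q κ δ A E φ₀ α₁ ψ₂ E₁ η : ℝ} (ht : t₁ ≤ t₂)
    (hR : 0 < R₂) (hQ : R₂ ^ 2 + ε ^ 2 / M ≤ Q) (hκ0 : 0 < κ) (hκ1 : κ ≤ 1) (hA : 0 ≤ A)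
    (hring : ∀ u ∈ Icc t₁ t₂, Q ≤ X u 1 ^ 2 + X u 2 ^ 2)
    (hband : ∀ u ∈ Icc t₁ t₂, X u 1 ^ 2 < R₂ ^ 2)
    (hκ : ∀ u ∈ Icc t₁ t₂, κ * X u 2 ≤ √(R₂ ^ 2 - X u 1 ^ 2))
    (hpos : ∀ u ∈ Icc t₁ t₂, 0 < X u 2) (hsym : X t₂ 1 = -X t₁ 1) (hR₁ : 0 < R₁)
    (hring₁ : ∀ u ∈ Icc t₁ t₂, X u 1 ^ 2 + X u 2 ^ 2 ≤ R₁ ^ 2) (hδ0 : 0 ≤ δ)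
    (hδ : ∀ u ∈ Icc t₁ t₂, |arccos (X u 1 / R₁) - arccos (X u 1 / R₂)| ≤ δ)
    (hd : ∀ u ∈ Icc t₁ t₂, A * (sin ((C u - C r) / ρ ^ 2 + φ₀) ^ 2 - E) ≤ X u 3 ^ 2)
    (hα₁ : α₁ = arccos (X t₁ 1 / R₂))
    (hψ₂ : ψ₂ = -(α₁ + ((C t₁ - C r) / ρ ^ 2 + φ₀) + ε⁻¹ * M * (C t₂ - C t₁)))
    (hE₁ : E₁ = E + π * (κ⁻¹ - 1)) (hη : η = κ / (1 + (2 * δ + π / 2 * (κ⁻¹ - 1)) / sin α₁))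
    {t : ℝ} (ht₁ : t ∈ Icc t₁ t₂) (hhalf : C t₁ + C t₂ ≤ 2 * C t) :
    0 < η ∧ η ≤ 1 ∧ 0 < α₁ ∧ C t ≤ C t₂ ∧ α₁ + ε⁻¹ * M * κ * (C t₂ - C t) ≤ π / 2 ∧
      K * A * η / (ε⁻¹ * M * κ * R₂) *
          (swingPrim ψ₂ (-E₁) (α₁ + ε⁻¹ * M * κ * (C t₂ - C t)) - swingPrim ψ₂ (-E₁) α₁)
        ≤ X t₂ 4 - X t 4 := by
  obtain ⟨lam, hlam⟩ : ∃ lam : ℝ, lam = ε⁻¹ * M * κ := ⟨_, rfl⟩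
  rw [← hlam]
  have hμ0 : 0 < ε⁻¹ * M := by positivity
  have hlam0 : 0 < lam := by rw [hlam]; positivity
  have hρ2 : (ρ ^ 2)⁻¹ = ε⁻¹ * M := inv_eq_of_mul_eq_one_left hlat
  have hκinv : 0 ≤ κ⁻¹ - 1 := sub_nonneg.2 ((one_le_inv₀ hκ0).2 hκ1)
  have hkk : κ⁻¹ * κ = 1 := inv_mul_cancel₀ hκ0.ne'
  have hpos' : ∀ u ∈ Icc t₁ t₂, 0 ≤ X u 2 := fun u hu => (hpos u hu).le
  -- `C` is non-decreasing on the band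
  have hCm := Thm53.monotoneOn_sub_of_le_deriv (f := C) (f' := fun u => X u 2)
    (Φ := fun _ => (0 : ℝ)) (φ := fun _ => 0) (convex_Icc t₁ t₂) (fun u _ => hC u)
    (fun u _ => hasDerivAt_const u 0) (fun u hu => hpos' u hu)
  -- the entry angle: `0 < α₁ ≤ π/2`
  obtain ⟨-, hw2, hα0⟩ := swing_window hX h0 hC hε hM ht hR hQ hring hband hκ hsym
    (left_mem_Icc.2 ht)
  rw [← hα₁] at hw2 hα0
  have hα2 : α₁ ≤ π / 2 := by
    have hc12 := hCm (left_mem_Icc.2 ht) (right_mem_Icc.2 ht) ht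
    dsimp only at hc12
    have := mul_nonneg hlam0.le (by linarith only [hc12] : (0 : ℝ) ≤ C t₂ - C t₁)
    rw [hlam] at this
    linarith only [hw2, this]
  have hsα : 0 < sin α₁ := sin_pos_of_pos_of_lt_pi hα0 (by linarith only [hα2, pi_pos])
  -- the slack `ℓ` of the upper window and the factor `η`
  obtain ⟨ℓ, hℓ⟩ : ∃ ℓ : ℝ, ℓ = 2 * δ + π / 2 * (κ⁻¹ - 1) := ⟨_, rfl⟩
  rw [← hℓ] at hη
  have hℓ0 : 0 ≤ ℓ := by rw [hℓ]; positivity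
  have hden : 0 < 1 + ℓ / sin α₁ := by positivity
  have hη0 : 0 < η := by rw [hη]; positivity
  have hη1 : η ≤ 1 := by
    rw [hη, div_le_one hden]
    have : 0 ≤ ℓ / sin α₁ := by positivity
    linarith only [hκ1, this]
  -- the pointwise facts on `[t, t₂]`
  have KEY : ∀ s ∈ Icc t t₂, 0 < swingAngleBack α₁ lam C t₂ s ∧
      swingAngleBack α₁ lam C t₂ s ≤ π / 2 ∧ C s ≤ C t₂ ∧ K * A * η / (lam * R₂) *
        ((sin (swingAngleBack α₁ lam C t₂ s + ψ₂) ^ 2 - E₁) / sin (swingAngleBack α₁ lam C t₂ s)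
          * (lam * X s 2)) ≤ K * X s 3 ^ 2 := by
    intro s hs
    have hs2 : s ∈ Icc t₁ t₂ := ⟨ht₁.1.trans hs.1, hs.2⟩
    obtain ⟨h1, h2, -⟩ := swing_window hX h0 hC hε hM ht hR hQ hring hband hκ hsym hs2
    obtain ⟨-, h3, -⟩ := swing_window_upper hX hC hε hM.le ht hR₁ hring₁ hpos hδ hsym hs2
    rw [← hlam, ← hα₁] at h1 h2
    rw [← hα₁] at h3
    have hc2 := hCm hs2 (right_mem_Icc.2 ht) hs.2
    have hc3 := hCm ht₁ hs2 hs.1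
    dsimp only at hc2 hc3
    have hc2' : C s ≤ C t₂ := by linarith only [hc2]
    have hsecond : lam * (C t₂ - C s) ≤ lam * (C s - C t₁) :=
      mul_le_mul_of_nonneg_left (by linarith only [hc3, hhalf]) hlam0.le
    unfold swingAngleBack
    obtain ⟨v, hv⟩ : ∃ v : ℝ, v = α₁ + lam * (C t₂ - C s) := ⟨_, rfl⟩
    rw [← hv]
    have hvle : v ≤ arccos (X s 1 / R₂) := by rw [hv]; linarith only [h1, hsecond]
    have hvge : arccos (X s 1 / R₂) ≤ π - v := by rw [hv]; linarith only [h2]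
    have hlv0 : 0 ≤ lam * (C t₂ - C s) := mul_nonneg hlam0.le (sub_nonneg.2 hc2')
    have hv0 : 0 < v := by rw [hv]; linarith only [hlv0, hα0]
    have hvπ : v ≤ π / 2 := by linarith only [hvle, hvge]
    have hsv : 0 < sin v := sin_pos_of_pos_of_lt_pi hv0 (by linarith only [hvπ, pi_pos])
    have hsinv : sin α₁ ≤ sin v := by
      refine sin_le_sin_of_le_of_le_pi_div_two (by linarith only [hα0, pi_pos]) hvπ ?_
      rw [hv]
      linarith only [hlv0]
    -- the lag of the phase behind `-(v + ψ₂)`, and the clock angle from above: `π - α ≤ v + ℓ`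
    have hl2 : (κ⁻¹ - 1) * (lam * (C t₂ - C s)) = (ε⁻¹ * M - lam) * (C t₂ - C s) := by
      rw [hlam]
      calc (κ⁻¹ - 1) * (ε⁻¹ * M * κ * (C t₂ - C s))
            = (κ⁻¹ * κ) * (ε⁻¹ * M * (C t₂ - C s)) - ε⁻¹ * M * κ * (C t₂ - C s) := by ring
        _ = (ε⁻¹ * M - ε⁻¹ * M * κ) * (C t₂ - C s) := by rw [hkk]; ring
    have hle : lam * (C t₂ - C s) ≤ π / 2 := by linarith only [hvπ, hv, hα0]
    have hlagn : 0 ≤ (ε⁻¹ * M - lam) * (C t₂ - C s) := by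
      rw [← hl2]
      exact mul_nonneg hκinv hlv0
    have hlag : (ε⁻¹ * M - lam) * (C t₂ - C s) ≤ π / 2 * (κ⁻¹ - 1) := by
      rw [← hl2]
      have := mul_le_mul_of_nonneg_left hle hκinv
      linarith only [this]
    have hup : π - arccos (X s 1 / R₂) ≤ v + ℓ := by
      have e : π - α₁ - 2 * δ - ε⁻¹ * M * (C t₂ - C s)
          = π - (v + 2 * δ + (ε⁻¹ * M - lam) * (C t₂ - C s)) := by rw [hv]; ring
      rw [e] at h3
      rw [hℓ]
      linarith only [h3, hlag]
    -- the trigger from above: `ηc ≤ R₂ sin v`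
    have hκs : κ * X s 2 ≤ R₂ * sin (arccos (X s 1 / R₂)) := by
      rw [Real.sin_arccos, clock_ring_sqrt hR, mul_div_cancel₀ _ hR.ne']
      exact hκ s hs2
    have hsinup : sin (arccos (X s 1 / R₂)) ≤ sin v + ℓ := by
      rw [← Real.sin_pi_sub]
      exact sin_le_sin_add_of_le (by linarith only [hvge]) hup
    have hηc : η * X s 2 ≤ R₂ * sin v := by
      rw [hη, div_mul_eq_mul_div, div_le_iff₀ hden]
      have h5 : κ * X s 2 ≤ R₂ * (sin v + ℓ) :=
        hκs.trans (mul_le_mul_of_nonneg_left hsinup hR.le)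
      have h8 : ℓ ≤ sin v * (ℓ / sin α₁) := by
        rw [← mul_div_assoc, le_div_iff₀ hsα]
        nlinarith only [hsinv, hℓ0]
      have h6 : R₂ * (sin v + ℓ) ≤ R₂ * sin v * (1 + ℓ / sin α₁) := by
        have := mul_le_mul_of_nonneg_left h8 hR.le
        nlinarith only [this]
      exact h5.trans h6
    -- the phase of the transfer mode is `-(v + ψ₂)` up to the lag
    have hl1 : (C s - C r) / ρ ^ 2 + φ₀ = -((v + ψ₂) + (ε⁻¹ * M - lam) * (C t₂ - C s)) := by
      rw [hv, hψ₂, div_eq_mul_inv, div_eq_mul_inv, hρ2]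
      ring
    have hds : A * (sin (v + ψ₂) ^ 2 - E₁) ≤ X s 3 ^ 2 := by
      have h := hd s hs2
      rw [hl1, sin_neg, neg_sq] at h
      have hsh := mul_le_mul_of_nonneg_left
        (sin_sq_shift_ge (v + ψ₂) ((ε⁻¹ * M - lam) * (C t₂ - C s))) hA
      rw [abs_of_nonneg hlagn] at hsh
      have hlb' := mul_le_mul_of_nonneg_left hlag hA
      rw [hE₁]
      nlinarith only [h, hsh, hlb', hA]
    exact ⟨hv0, hvπ, hc2',
      swing_step_ge hK hA hlam0 hR hsv hη0.le (hpos' s hs2) hds (sq_nonneg _) hηc⟩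
  -- the comparison `ã + (KAη/(λR₂))·swingPrim ψ₂ (-E₁) (v)` is non-decreasing on `[t, t₂]`
  have hmono := Thm53.monotoneOn_sub_of_le_deriv (f := fun s => X s 4)
    (f' := fun s => K * X s 3 ^ 2)
    (Φ := fun s => -(K * A * η / (lam * R₂) * swingPrim ψ₂ (-E₁) (swingAngleBack α₁ lam C t₂ s)))
    (φ := fun s => K * A * η / (lam * R₂) *
      ((sin (swingAngleBack α₁ lam C t₂ s + ψ₂) ^ 2 - E₁) / sin (swingAngleBack α₁ lam C t₂ s)
        * (lam * X s 2)))
    (convex_Icc t t₂) (fun s _ => RotorKnob.hasDerivAt_e hX s)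
    (fun s hs => ((((hasDerivAt_swingPrim ψ₂ (-E₁) (KEY s hs).1
      (by linarith only [(KEY s hs).2.1, pi_pos])).comp s
        (hasDerivAt_swingAngleBack hC α₁ lam t₂ s)).const_mul (K * A * η / (lam * R₂))).neg
          ).congr_deriv (by ring))
    (fun s hs => (KEY s hs).2.2.2)
  have h := hmono (left_mem_Icc.2 ht₁.2) (right_mem_Icc.2 ht₁.2) ht₁.2
  have hK1 := KEY t (left_mem_Icc.2 ht₁.2)
  simp only [swingAngleBack, sub_self, mul_zero, add_zero, sub_neg_eq_add] at h hK1
  exact ⟨hη0, hη1, hα0, hK1.2.2.1, hK1.2.1, by linarith only [h]⟩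

/-! ## §294 The band floor -/

/-- §294 THE BAND FLOOR (hypotheses of §293 / part 109 §292(b) with BOTH offsets `ψ₁`, `ψ₂`,
`E ≥ 0` and `cos²ψ₁ - sin²ψ₁ + cos²ψ₂ - sin²ψ₂ ≥ 0`): splitting at a dose midpoint
`2C(t_m) = C(t₁) + C(t₂)` (intermediate value theorem), where the two comparison angles agree
(`= ω`, `α₁ ≤ ω ≤ π/2`, `cos ω ≤ (1 - κ)π/2 + δ` by part 109 §292(c)), adding the two
half-band laws from below and pricing them by part 109 §291(d):
`(KAη/(λR₂))·((cos²ψ₁ - sin²ψ₁ + cos²ψ₂ - sin²ψ₂)(cos α₁ - ((1 - κ)π/2 + δ))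
- (|sin 2ψ₁| + |sin 2ψ₂|)(1 - sin α₁) + 2E₁(log sin(α₁/2) - log cos(α₁/2))) ≤ ã(t₂) - ã(t₁)`.
[derived: part 109 §291(d), §292(b)–(c); this file §293] -/
theorem swing_transfer_band_ge
    (hX : ∀ t, HasDerivAt X (RotorKnob.rotorCircuit K M ε ρ (X t)) t) (h0 : X 0 = delayInit)
    (hC : ∀ t, HasDerivAt C (X t 2) t) (hK : 0 ≤ K) (hε : 0 < ε) (hM : 0 < M)
    (hlat : ε⁻¹ * M * ρ ^ 2 = 1) {t₁ t₂ r R₁ R₂ Q κ δ A E φ₀ α₁ ψ₁ ψ₂ E₁ η : ℝ} (ht : t₁ ≤ t₂)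
    (hR : 0 < R₂) (hQ : R₂ ^ 2 + ε ^ 2 / M ≤ Q) (hκ0 : 0 < κ) (hκ1 : κ ≤ 1) (hA : 0 ≤ A)
    (hE : 0 ≤ E) (hring : ∀ u ∈ Icc t₁ t₂, Q ≤ X u 1 ^ 2 + X u 2 ^ 2)
    (hband : ∀ u ∈ Icc t₁ t₂, X u 1 ^ 2 < R₂ ^ 2)
    (hκ : ∀ u ∈ Icc t₁ t₂, κ * X u 2 ≤ √(R₂ ^ 2 - X u 1 ^ 2))
    (hpos : ∀ u ∈ Icc t₁ t₂, 0 < X u 2) (hsym : X t₂ 1 = -X t₁ 1) (hR₁ : 0 < R₁)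
    (hring₁ : ∀ u ∈ Icc t₁ t₂, X u 1 ^ 2 + X u 2 ^ 2 ≤ R₁ ^ 2) (hδ0 : 0 ≤ δ)
    (hδ : ∀ u ∈ Icc t₁ t₂, |arccos (X u 1 / R₁) - arccos (X u 1 / R₂)| ≤ δ)
    (hd : ∀ u ∈ Icc t₁ t₂, A * (sin ((C u - C r) / ρ ^ 2 + φ₀) ^ 2 - E) ≤ X u 3 ^ 2)
    (hα₁ : α₁ = arccos (X t₁ 1 / R₂)) (hψ₁ : ψ₁ = (C t₁ - C r) / ρ ^ 2 + φ₀ - α₁)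
    (hψ₂ : ψ₂ = -(α₁ + ((C t₁ - C r) / ρ ^ 2 + φ₀) + ε⁻¹ * M * (C t₂ - C t₁)))
    (hE₁ : E₁ = E + π * (κ⁻¹ - 1)) (hη : η = κ / (1 + (2 * δ + π / 2 * (κ⁻¹ - 1)) / sin α₁))
    (hcψ : 0 ≤ cos ψ₁ ^ 2 - sin ψ₁ ^ 2 + (cos ψ₂ ^ 2 - sin ψ₂ ^ 2)) :
    K * A * η / (ε⁻¹ * M * κ * R₂) *
        ((cos ψ₁ ^ 2 - sin ψ₁ ^ 2 + (cos ψ₂ ^ 2 - sin ψ₂ ^ 2))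
            * (cos α₁ - ((1 - κ) * (π / 2) + δ))
          - (|sin (2 * ψ₁)| + |sin (2 * ψ₂)|) * (1 - sin α₁)
          + 2 * E₁ * (log (sin (α₁ / 2)) - log (cos (α₁ / 2))))
      ≤ X t₂ 4 - X t₁ 4 := by
  -- a dose midpoint exists
  have hcont : ContinuousOn C (Icc t₁ t₂) := fun u _ => (hC u).continuousAt.continuousWithinAt
  have hCm := Thm53.monotoneOn_sub_of_le_deriv (f := C) (f' := fun u => X u 2)
    (Φ := fun _ => (0 : ℝ)) (φ := fun _ => 0) (convex_Icc t₁ t₂) (fun u _ => hC u)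
    (fun u _ => hasDerivAt_const u 0) (fun u hu => (hpos u hu).le)
  have hc12 := hCm (left_mem_Icc.2 ht) (right_mem_Icc.2 ht) ht
  dsimp only at hc12
  have hmid : (C t₁ + C t₂) / 2 ∈ Icc (C t₁) (C t₂) := by
    constructor <;> linarith only [hc12]
  obtain ⟨tm, htm, hCtm⟩ := intermediate_value_Icc ht hcont hmid
  have hle : 2 * C tm ≤ C t₁ + C t₂ := by rw [hCtm]; linarith only
  have hge : C t₁ + C t₂ ≤ 2 * C tm := by rw [hCtm]; linarith only
  -- the two half-band laws from below at the midpoint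
  obtain ⟨hη0, -, hα0, hc1, hwπ, h1⟩ := swing_transfer_first_ge hX h0 hC hK hε hM hlat ht hR hQ
    hκ0 hκ1 hA hring hband hκ hpos hsym hR₁ hring₁ hδ0 hδ hd hα₁ hψ₁ hE₁ hη htm hle
  obtain ⟨-, -, -, -, -, h2⟩ := swing_transfer_second_ge hX h0 hC hK hε hM hlat ht hR hQ hκ0
    hκ1 hA hring hband hκ hpos hsym hR₁ hring₁ hδ0 hδ hd hα₁ hψ₂ hE₁ hη htm hge
  -- at the midpoint the two comparison angles agree: `v(t_m) = w(t_m) = ω`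
  have hvw : C t₂ - C tm = C tm - C t₁ := by rw [hCtm]; ring
  rw [hvw] at h2
  obtain ⟨-, hcos⟩ := swing_midpoint_angle hX hC hε hM.le ht hR₁ hring₁ hpos hδ hsym hκ0 hκ1
    hα₁ hα0 htm hge hwπ
  obtain ⟨ω, hω⟩ : ∃ ω : ℝ, ω = α₁ + ε⁻¹ * M * κ * (C tm - C t₁) := ⟨_, rfl⟩
  rw [← hω] at h1 h2 hcos hwπ
  have hE₁0 : 0 ≤ E₁ := by
    rw [hE₁]
    have : 0 ≤ κ⁻¹ - 1 := sub_nonneg.2 ((one_le_inv₀ hκ0).2 hκ1)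
    positivity
  have hlam0 : 0 < ε⁻¹ * M * κ := by positivity
  have hαω : α₁ ≤ ω := by
    rw [hω]
    have := mul_nonneg hlam0.le (sub_nonneg.2 hc1)
    linarith only [this]
  have hev1 := swingPrim_eval_ge ψ₁ hE₁0 hα0 hαω hwπ
  have hev2 := swingPrim_eval_ge ψ₂ hE₁0 hα0 hαω hwπ
  have hcoef : 0 ≤ K * A * η / (ε⁻¹ * M * κ * R₂) := by
    have := hη0.le
    positivity
  -- the midpoint cosine bound enters with the sign of `cos 2ψ₁ + cos 2ψ₂`
  have hm := mul_le_mul_of_nonneg_left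
    (sub_le_sub_left hcos (cos α₁) :
      cos α₁ - ((1 - κ) * (π / 2) + δ) ≤ cos α₁ - cos ω) hcψ
  have key : (cos ψ₁ ^ 2 - sin ψ₁ ^ 2 + (cos ψ₂ ^ 2 - sin ψ₂ ^ 2))
            * (cos α₁ - ((1 - κ) * (π / 2) + δ))
          - (|sin (2 * ψ₁)| + |sin (2 * ψ₂)|) * (1 - sin α₁)
          + 2 * E₁ * (log (sin (α₁ / 2)) - log (cos (α₁ / 2)))
      ≤ (swingPrim ψ₁ (-E₁) ω - swingPrim ψ₁ (-E₁) α₁)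
          + (swingPrim ψ₂ (-E₁) ω - swingPrim ψ₂ (-E₁) α₁) := by
    nlinarith only [hm, hev1, hev2]
  have hfin := mul_le_mul_of_nonneg_left key hcoef
  rw [mul_add] at hfin
  linarith only [hfin, h1, h2]

/-! ## §295 A device for the sequel: the angle gap -/

/-- §295 THE ANGLE GAP (for the discharge of `δ` in the sequel): for `|x|, |y| ≤ m < 1`,
`|arccos x - arccos y| ≤ |x - y|/√(1 - m²)` (the mean value theorem on `[-m, m]`, where
`arccos' = -1/√(1 - x²)` has size `≤ 1/√(1 - m²)`). On the band of the sequel `x = b/R₁`,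
`y = b/R₂`, `|x - y| ≤ (R₁ - R₂)/R₁ ≈ 1.6·10⁻⁶` and `√(1 - m²) ≈ sin α₁ ≈ 0.248`, so
`δ ≈ 6.5·10⁻⁶`. [derived: Mathlib `Convex.norm_image_sub_le_of_norm_hasDerivWithin_le`] -/
theorem abs_arccos_sub_arccos_le {x y m : ℝ} (hm : m < 1) (hx : |x| ≤ m) (hy : |y| ≤ m) :
    |arccos x - arccos y| ≤ |x - y| / √(1 - m ^ 2) := by
  have hm0 : 0 ≤ m := (abs_nonneg x).trans hx
  have h1m : 0 < 1 - m ^ 2 := by nlinarith only [hm, hm0]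
  have hs : 0 < √(1 - m ^ 2) := Real.sqrt_pos.2 h1m
  have key := Convex.norm_image_sub_le_of_norm_hasDerivWithin_le
    (f := arccos) (f' := fun z => -(1 / √(1 - z ^ 2))) (s := Icc (-m) m) (x := y) (y := x)
    (C := 1 / √(1 - m ^ 2))
    (fun z hz => (Real.hasDerivAt_arccos (ne_of_gt (by linarith only [hz.1, hm] : -1 < z))
      (ne_of_lt (by linarith only [hz.2, hm] : z < 1))).hasDerivWithinAt)
    (fun z hz => by
      have hz2 : 1 - m ^ 2 ≤ 1 - z ^ 2 := by nlinarith only [hz.1, hz.2, hm0]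
      rw [norm_neg, Real.norm_of_nonneg (by positivity)]
      exact one_div_le_one_div_of_le hs (Real.sqrt_le_sqrt hz2))
    (convex_Icc _ _) (mem_Icc.2 (abs_le.1 hy)) (mem_Icc.2 (abs_le.1 hx))
  rw [Real.norm_eq_abs, Real.norm_eq_abs] at key
  calc |arccos x - arccos y| ≤ 1 / √(1 - m ^ 2) * |x - y| := key
    _ = |x - y| / √(1 - m ^ 2) := by ring

end Summit.NavierStokesRegularity.FluidComputer.GateBudget
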